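import Mathlib
import HarnessLib
import Literature.MathematicalPhysics.StatisticalMechanics.ComplexGradientStiffness
import Summits.HubbardSuperconductivity.HubbardSuperconductivity.Theorems.ComplexGFFStiffnessDefs
import Summits.HubbardSuperconductivity.HubbardSuperconductivity.Theorems.ComplexGFFStiffnessHypACumulantPertK

/-!
# Crux `HypACumulant`, line `gnv` — the reduction `GNV → ZNonvanishing`

Route `route-HubbardSuperconductivity-ComplexGFFStiffness`, crux item stmt-HubbardSuperconductivity-19154
(`…Theses.ComplexGFFStiffness.HypACumulant`; shared first rung with stmt-…-19155).  The registered
stub `stub_zNonvanishing : ZNonvanishing` (N-uniform non-vanishing of `Z_{L^N}(g,0)` for the complex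
gradient GFF⁴ model) follows from the line's research stub `GNV` (`…Theorems.ComplexGFF.GNV`:
Adams–Buchholz–Kotecký–Müller's Theorem 2.2, representation half, transcribed to `ι`-admissible
COMPLEX single-site gradient perturbations), because the model's perturbation
`𝒦_g = exp(−i g 𝒜) − 1` lies in every ball of the complexified `ι`-symmetric space `E_{1/2,|·|²}`
once `g` is small (the derivative calculus is in `ComplexGFFStiffnessHypACumulantPertK.lean`).

## Contents (all proved; no definition, no named fact)
* `norm_iteratedFDeriv_pertK_le` — for every order `r₀` a constant `B` with
  `‖D^k 𝒦_g(z)‖ ≤ g^{1/3} · B · e^{Σ_i z_i²/4}` for all `k ≤ r₀`, `0 ≤ g ≤ 1`, `z ∈ ℝ⁴`;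
* `pertK_isIotaAdmissible` — `𝒦_g` is `ι`-admissible with any data `(r₀, ρ)`, `ρ > 0`, for all
  `0 ≤ g ≤ g₀ = min 1 (ρ/B)³`;
* `zNonvanishing_of_gnv : GNV → ZNonvanishing` — the composition used by the line's skeleton
  (`L₀` from `GNV`; for each base `L`, `g₀(L)` is the admissibility threshold for `ρ(L)`).

## References
* S. Adams, S. Buchholz, R. Kotecký, S. Müller, arXiv:1910.13564, Sec. 2.1 and Theorem 2.2.
-/

noncomputable section

-- `Summit.<Summit>.<Problem>`: single-conjunct summit, the duplicate component is mandated (D-0017).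
set_option linter.dupNamespace false

namespace Summit.HubbardSuperconductivity.HubbardSuperconductivity.Theorems.ComplexGFF

open scoped BigOperators ComplexConjugate
open MeasureTheory
open Literature.MathematicalPhysics.StatisticalMechanics.ComplexGradientGFF4 (Z ev Y D S X w)

/-- Polynomial weights are dominated by the Gaussian weight `e^{s²/4}`. -/
theorem one_add_pow_le_exp (m : ℕ) :
    ∃ C : ℝ, 0 < C ∧ ∀ s : ℝ, 0 ≤ s → (1 + s) ^ m ≤ C * Real.exp (s ^ 2 / 4) := by
  refine ⟨2 ^ m * (4 ^ m * m.factorial) + 2 ^ m, by positivity, fun s hs => ?_⟩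
  have hexp1 : 1 ≤ Real.exp (s ^ 2 / 4) := Real.one_le_exp (by positivity)
  rcases le_or_gt s 1 with h1 | h1
  · have h2 : (1 + s) ^ m ≤ 2 ^ m := pow_le_pow_left₀ (by linarith) (by linarith) m
    calc (1 + s) ^ m ≤ 2 ^ m := h2
      _ ≤ (2 ^ m * (4 ^ m * m.factorial) + 2 ^ m) * 1 := by
          rw [mul_one]; exact le_add_of_nonneg_left (by positivity)
      _ ≤ (2 ^ m * (4 ^ m * m.factorial) + 2 ^ m) * Real.exp (s ^ 2 / 4) :=
          mul_le_mul_of_nonneg_left hexp1 (by positivity)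
  · have h2 : (1 + s) ^ m ≤ (2 * s) ^ m := pow_le_pow_left₀ (by linarith) (by linarith) m
    have h3 : s ^ m ≤ s ^ (2 * m) := pow_le_pow_right₀ h1.le (by omega)
    have h4 : (s ^ 2 / 4) ^ m / m.factorial ≤ Real.exp (s ^ 2 / 4) :=
      Real.pow_div_factorial_le_exp _ (by positivity) m
    have hm : (0 : ℝ) < m.factorial := by exact_mod_cast m.factorial_pos
    rw [div_le_iff₀ hm] at h4
    have h5 : s ^ (2 * m) = 4 ^ m * (s ^ 2 / 4) ^ m := by
      rw [pow_mul, ← mul_pow]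
      congr 1
      ring
    calc (1 + s) ^ m ≤ (2 * s) ^ m := h2
      _ = 2 ^ m * s ^ m := mul_pow 2 s m
      _ ≤ 2 ^ m * s ^ (2 * m) := mul_le_mul_of_nonneg_left h3 (by positivity)
      _ = 2 ^ m * (4 ^ m * (s ^ 2 / 4) ^ m) := by rw [h5]
      _ ≤ 2 ^ m * (4 ^ m * (Real.exp (s ^ 2 / 4) * m.factorial)) := by gcongr
      _ = 2 ^ m * (4 ^ m * m.factorial) * Real.exp (s ^ 2 / 4) := by ring
      _ ≤ (2 ^ m * (4 ^ m * m.factorial) + 2 ^ m) * Real.exp (s ^ 2 / 4) := by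
          gcongr
          exact le_add_of_nonneg_right (by positivity)

/-- `‖z‖² ≤ Σ_i z_i²` (sup norm versus the Euclidean form in the weight). -/
theorem norm_sq_le_sum_sq (z : Fin 4 → ℝ) : ‖z‖ ^ 2 ≤ ∑ i : Fin 4, (z i) ^ 2 := by
  have h0 : 0 ≤ ∑ i : Fin 4, (z i) ^ 2 := Finset.sum_nonneg (fun i _ => sq_nonneg _)
  have h1 : ‖z‖ ≤ Real.sqrt (∑ i : Fin 4, (z i) ^ 2) := by
    refine (pi_norm_le_iff_of_nonneg (Real.sqrt_nonneg _)).mpr (fun i => ?_)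
    rw [Real.norm_eq_abs, ← Real.sqrt_sq_eq_abs]
    exact Real.sqrt_le_sqrt
      (Finset.single_le_sum (f := fun j : Fin 4 => (z j) ^ 2) (fun j _ => sq_nonneg _)
        (Finset.mem_univ i))
  calc ‖z‖ ^ 2 ≤ (Real.sqrt (∑ i : Fin 4, (z i) ^ 2)) ^ 2 := pow_le_pow_left₀ (norm_nonneg _) h1 2
    _ = ∑ i : Fin 4, (z i) ^ 2 := Real.sq_sqrt h0

/-- **Uniform derivative bound.** For every order `r₀` there is `B > 0` with
`‖D^k 𝒦_g(z)‖ ≤ g^{1/3} · B · e^{Σ_i z_i²/4}` for all `k ≤ r₀`, `0 ≤ g ≤ 1` and `z ∈ ℝ⁴`. -/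
theorem norm_iteratedFDeriv_pertK_le (r₀ : ℕ) :
    ∃ B : ℝ, 0 < B ∧ ∀ g : ℝ, 0 ≤ g → g ≤ 1 → ∀ k : ℕ, k ≤ r₀ → ∀ z : Fin 4 → ℝ,
      ‖iteratedFDeriv ℝ k (pertK g) z‖
        ≤ g ^ ((3 : ℝ)⁻¹) * B * Real.exp ((∑ i : Fin 4, (z i) ^ 2) / 4) := by
  obtain ⟨C, hC, hCle⟩ := one_add_pow_le_exp (2 * r₀ + 3)
  set A : ℝ := max 3 ((r₀.factorial : ℝ) * 18 ^ r₀) with hAdef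
  have hA3 : (3 : ℝ) ≤ A := le_max_left _ _
  have hAr : (r₀.factorial : ℝ) * 18 ^ r₀ ≤ A := le_max_right _ _
  have hA0 : 0 < A := lt_of_lt_of_le (by norm_num) hA3
  refine ⟨A * C, by positivity, ?_⟩
  intro g hg0 hg1 k hk z
  set c : ℝ := g ^ ((3 : ℝ)⁻¹) with hcdef
  have hc0 : 0 ≤ c := Real.rpow_nonneg hg0 _
  have hc1 : c ≤ 1 := Real.rpow_le_one hg0 hg1 (by norm_num)
  have hc3 : c ^ 3 = g := by
    have h := Real.rpow_inv_natCast_pow hg0 (n := 3) (by norm_num)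
    simpa using h
  have hz : 0 ≤ ‖z‖ := norm_nonneg z
  have h1z : 1 ≤ 1 + ‖z‖ := by linarith
  -- Step 1: `‖D^k 𝒦_g(z)‖ ≤ c · A · (1 + ‖z‖)^{2 r₀ + 3}`
  have step1 : ‖iteratedFDeriv ℝ k (pertK g) z‖ ≤ c * A * (1 + ‖z‖) ^ (2 * r₀ + 3) := by
    rcases Nat.eq_zero_or_pos k with hk0 | hkpos
    · subst hk0
      rw [norm_iteratedFDeriv_zero]
      have h := norm_pertK_le hg0 z
      have hzz : ‖z‖ ^ 3 ≤ (1 + ‖z‖) ^ (2 * r₀ + 3) :=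
        le_trans (pow_le_pow_left₀ hz (by linarith) 3) (pow_le_pow_right₀ h1z (by omega))
      have hgc : g ≤ c := by
        rw [← hc3]
        calc c ^ 3 ≤ c ^ 1 := pow_le_pow_of_le_one hc0 hc1 (by norm_num)
          _ = c := pow_one c
      calc ‖pertK g z‖ ≤ 3 * g * ‖z‖ ^ 3 := h
        _ ≤ A * c * (1 + ‖z‖) ^ (2 * r₀ + 3) := by
            apply mul_le_mul (mul_le_mul hA3 hgc hg0 hA0.le) hzz (pow_nonneg hz 3) (by positivity)
        _ = c * A * (1 + ‖z‖) ^ (2 * r₀ + 3) := by ring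
    · have h := norm_iteratedFDeriv_pertK_le_scaled hc3 k z
      have h1 := norm_iteratedFDeriv_pertK_one_le hkpos (c • z)
      have hcz : ‖c • z‖ ≤ ‖z‖ := by
        rw [norm_smul, Real.norm_eq_abs, abs_of_nonneg hc0]
        exact mul_le_of_le_one_left hz hc1
      have h18 : (18 : ℝ) * (1 + ‖c • z‖) ^ 2 ≤ 18 * (1 + ‖z‖) ^ 2 := by
        gcongr
      have h18' : (1 : ℝ) ≤ 18 * (1 + ‖z‖) ^ 2 := by nlinarith
      have hck : |c| ^ k ≤ c := by
        rw [abs_of_nonneg hc0]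
        calc c ^ k ≤ c ^ 1 := pow_le_pow_of_le_one hc0 hc1 hkpos
          _ = c := pow_one c
      have hfac : (k.factorial : ℝ) ≤ r₀.factorial := by exact_mod_cast Nat.factorial_le hk
      have hpow : ((18 : ℝ) * (1 + ‖c • z‖) ^ 2) ^ k ≤ (18 * (1 + ‖z‖) ^ 2) ^ r₀ :=
        le_trans (pow_le_pow_left₀ (by positivity) h18 k) (pow_le_pow_right₀ h18' hk)
      have hpoly : ((18 : ℝ) * (1 + ‖z‖) ^ 2) ^ r₀ = 18 ^ r₀ * (1 + ‖z‖) ^ (2 * r₀) := by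
        rw [mul_pow, ← pow_mul]
      calc ‖iteratedFDeriv ℝ k (pertK g) z‖
          ≤ ‖iteratedFDeriv ℝ k (pertK 1) (c • z)‖ * |c| ^ k := h
        _ ≤ ((k.factorial : ℝ) * (18 * (1 + ‖c • z‖) ^ 2) ^ k) * c :=
            mul_le_mul h1 hck (pow_nonneg (abs_nonneg c) k) (by positivity)
        _ ≤ ((r₀.factorial : ℝ) * (18 ^ r₀ * (1 + ‖z‖) ^ (2 * r₀ + 3))) * c := by
            apply mul_le_mul_of_nonneg_right _ hc0
            calc (k.factorial : ℝ) * (18 * (1 + ‖c • z‖) ^ 2) ^ k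
                ≤ r₀.factorial * (18 * (1 + ‖z‖) ^ 2) ^ r₀ :=
                  mul_le_mul hfac hpow (by positivity) (by positivity)
              _ = r₀.factorial * (18 ^ r₀ * (1 + ‖z‖) ^ (2 * r₀)) := by rw [hpoly]
              _ ≤ r₀.factorial * (18 ^ r₀ * (1 + ‖z‖) ^ (2 * r₀ + 3)) :=
                  mul_le_mul_of_nonneg_left (mul_le_mul_of_nonneg_left
                    (pow_le_pow_right₀ h1z (by omega)) (by positivity)) (by positivity)
        _ = c * ((r₀.factorial : ℝ) * 18 ^ r₀) * (1 + ‖z‖) ^ (2 * r₀ + 3) := by ring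
        _ ≤ c * A * (1 + ‖z‖) ^ (2 * r₀ + 3) := by gcongr
  -- Step 2: the polynomial weight is dominated by the Gaussian weight
  have step2 : (1 + ‖z‖) ^ (2 * r₀ + 3) ≤ C * Real.exp ((∑ i : Fin 4, (z i) ^ 2) / 4) := by
    refine le_trans (hCle ‖z‖ hz) (mul_le_mul_of_nonneg_left ?_ hC.le)
    exact Real.exp_le_exp.mpr (by linarith [norm_sq_le_sum_sq z])
  calc ‖iteratedFDeriv ℝ k (pertK g) z‖ ≤ c * A * (1 + ‖z‖) ^ (2 * r₀ + 3) := step1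
    _ ≤ c * A * (C * Real.exp ((∑ i : Fin 4, (z i) ^ 2) / 4)) :=
        mul_le_mul_of_nonneg_left step2 (by positivity)
    _ = c * (A * C) * Real.exp ((∑ i : Fin 4, (z i) ^ 2) / 4) := by ring

/-- **Admissibility of the model's perturbation.** For every order `r₀` and radius `ρ > 0` there
is `g₀ > 0` such that `𝒦_g` is `ι`-admissible with data `(r₀, ρ)` for all `0 ≤ g ≤ g₀`: the model
sits in every ball of the (complexified, `ι`-symmetric) space `E_{1/2,|·|²}` once the coupling is
small. -/
theorem pertK_isIotaAdmissible (r₀ : ℕ) {ρ : ℝ} (hρ : 0 < ρ) :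
    ∃ g₀ : ℝ, 0 < g₀ ∧ ∀ g : ℝ, 0 ≤ g → g ≤ g₀ → IsIotaAdmissible r₀ ρ (pertK g) := by
  obtain ⟨B, hB, hBle⟩ := norm_iteratedFDeriv_pertK_le r₀
  refine ⟨min 1 ((ρ / B) ^ 3), lt_min zero_lt_one (by positivity), ?_⟩
  intro g hg0 hg
  have hg1 : g ≤ 1 := le_trans hg (min_le_left _ _)
  have hg2 : g ≤ (ρ / B) ^ 3 := le_trans hg (min_le_right _ _)
  have hc : g ^ ((3 : ℝ)⁻¹) ≤ ρ / B := by
    have h := Real.rpow_le_rpow hg0 hg2 (by norm_num : (0 : ℝ) ≤ (3 : ℝ)⁻¹)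
    have h2 : ((ρ / B) ^ 3) ^ ((3 : ℝ)⁻¹) = ρ / B := by
      have := Real.pow_rpow_inv_natCast (div_pos hρ hB).le (n := 3) (by norm_num)
      simpa using this
    rwa [h2] at h
  refine ⟨contDiff_pertK g, fun k hk z => ?_, fun z => pertK_neg g z⟩
  calc ‖iteratedFDeriv ℝ k (pertK g) z‖
      ≤ g ^ ((3 : ℝ)⁻¹) * B * Real.exp ((∑ i : Fin 4, (z i) ^ 2) / 4) := hBle g hg0 hg1 k hk z
    _ ≤ (ρ / B) * B * Real.exp ((∑ i : Fin 4, (z i) ^ 2) / 4) := by gcongr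
    _ = ρ * Real.exp ((∑ i : Fin 4, (z i) ^ 2) / 4) := by field_simp

/-! ### The reduction -/

/-- **`GNV → ZNonvanishing`** (the composition of the line `gnv`): the generalised non-vanishing
statement for `ι`-admissible complex gradient perturbations implies the `N`-uniform non-vanishing
of `Z_{L^N}(g,0)` for the complex gradient GFF⁴ model, with the same `L₀` and, for each base `L`,
the threshold `g₀(L)` below which `𝒦_g` lies in the ball of radius `ρ(L)`. -/
theorem zNonvanishing_of_gnv (h : GNV) : ZNonvanishing := by
  obtain ⟨r₀, L₀, hL⟩ := h
  refine ⟨L₀, fun L hodd hle => ?_⟩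
  obtain ⟨ρ, hρ, hN⟩ := hL L hodd hle
  obtain ⟨g₀, hg₀, hadm⟩ := pertK_isIotaAdmissible r₀ hρ
  refine ⟨g₀, hg₀, fun g hg0 hg N hN1 n _ hn => ?_⟩
  rw [← pertZ_pertK g]
  exact hN N hN1 n hn (pertK g) (hadm g hg0 hg)

end Summit.HubbardSuperconductivity.HubbardSuperconductivity.Theorems.ComplexGFF

end
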